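import Mathlib
import Summits.Ventures.PercRepro2.Defs
import Summits.Ventures.PercRepro2.Graph
import Summits.Ventures.PercRepro2.RestrictClosure
import Summits.Ventures.PercRepro2.GcBlockPush
import Summits.Ventures.PercRepro2.GcBlockConn
import Summits.Ventures.PercRepro2.GcBundlePush

/-!
# Root bundles: connectivity through a bundle is the pattern of its terminals (blind cell
PercRepro2, typer-1 g57)

A **root bundle** (`IsBundle ends W a₁ a₂ v`) is a vertex set `W` with three terminals
`a₁, a₂, v ∉ W` such that every edge touching `W` has both ends in `W ∪ {a₁, a₂, v}` — the
three-terminal twin of the two-terminal block `Block.IsBlock` (`GcBlockConn.lean`), the hat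
(`Hat.IsHatAt`) being the case `W = {u}`. For the edge set `S = touches ends W` and two chosen
edges `eA ≠ eB` of `S`:

* **`bundleEnds ends S eA eB a₁ a₂ v`** — the incidence map with `eA` re-wired to `{a₁, v}`, `eB` to
  `{a₂, v}` and every other edge of `S` a loop at `v`; the observables are the block observables
  `Block.blockObs ends S a₁ v` («`a₁ ↔ v` inside `S`») and `Block.blockObs ends S a₂ v`;
* **`conn_bundle_iff`** — on a configuration with `a₁ ↮ a₂ inside `S`` (the admissible set
  `BundleG₀`), for two vertices `x, z ∉ W`: `x ↔ z` in the bundle graph under the bundle map iff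
  `x ↔ z` in the original graph. Both directions are closure arguments
  (`mem_of_conn_of_closed'`): a walk of the original graph crosses `W` only between terminals,
  and on the admissible configurations a crossing joins `a₁` or `a₂` to `v` — the open pattern
  edge; a walk of the bundle graph uses `eA` / `eB` only when the pattern is realised inside `S`.

With `GcBundlePush.lean` (the measure side) this is all the scaled transport `Scale.Gc_scale`
asks of the root-bundle reduction (`GcBundle.lean`). Standard axioms.
-/

namespace Summit.Ventures.PercRepro2

open SepPair Block

namespace Bundle

/-! ## The bundle and its collapsed incidence map -/

section Defs

variable {V : Type*} {E : Type*} [DecidableEq E]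

/-- **A root bundle**: the three terminals `a₁, a₂, v` are outside `W`, and every edge touching
`W` has both of its ends in `W ∪ {a₁, a₂, v}`. -/
structure IsBundle (ends : E → Sym2 V) (W : Set V) (a₁ a₂ v : V) : Prop where
  /-- `a₁ ∉ W` -/
  a₁_notMem : a₁ ∉ W
  /-- `a₂ ∉ W` -/
  a₂_notMem : a₂ ∉ W
  /-- `v ∉ W` -/
  v_notMem : v ∉ W
  /-- every edge touching `W` has both ends in `W ∪ {a₁, a₂, v}` -/
  ends_mem : ∀ e ∈ touches ends W, ∀ x y, ends e = s(x, y) →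
    (x ∈ W ∨ x = a₁ ∨ x = a₂ ∨ x = v) ∧ (y ∈ W ∨ y = a₁ ∨ y = a₂ ∨ y = v)

/-- **The bundle graph**: `eA` is re-wired to `{a₁, v}`, `eB` to `{a₂, v}`, every other edge of
`S` becomes a loop at `v`, the edges outside `S` are unchanged. -/
def bundleEnds (ends : E → Sym2 V) (S : Set E) [DecidablePred (· ∈ S)] (eA eB : E)
    (a₁ a₂ v : V) : E → Sym2 V :=
  fun e => if e = eA then s(a₁, v) else if e = eB then s(a₂, v) else if e ∈ S then s(v, v)
    else ends e

/-- **The admissible configurations of the instance**: `a₁ ↮ a₂` inside `S`. -/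
def BundleG₀ (ends : E → Sym2 V) (S : Set E) [DecidablePred (· ∈ S)] (a₁ a₂ : V) :
    Set (Config E) :=
  {ω | ¬ Conn ends (restrictTo S ω) a₁ a₂}

/-- `bundleEnds` at `eA`. -/
lemma bundleEnds_apply_A (ends : E → Sym2 V) (S : Set E) [DecidablePred (· ∈ S)] (eA eB : E)
    (a₁ a₂ v : V) : bundleEnds ends S eA eB a₁ a₂ v eA = s(a₁, v) := by
  simp [bundleEnds]

/-- `bundleEnds` at `eB ≠ eA`. -/
lemma bundleEnds_apply_B (ends : E → Sym2 V) (S : Set E) [DecidablePred (· ∈ S)] {eA eB : E}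
    (hAB : eA ≠ eB) (a₁ a₂ v : V) : bundleEnds ends S eA eB a₁ a₂ v eB = s(a₂, v) := by
  simp [bundleEnds, hAB.symm]

/-- `bundleEnds` on an edge of `S` other than `eA, eB`: a loop. -/
lemma bundleEnds_apply_of_mem (ends : E → Sym2 V) (S : Set E) [DecidablePred (· ∈ S)]
    {eA eB : E} (a₁ a₂ v : V) {e : E} (hA : e ≠ eA) (hB : e ≠ eB) (he : e ∈ S) :
    bundleEnds ends S eA eB a₁ a₂ v e = s(v, v) := by
  simp [bundleEnds, hA, hB, he]

/-- `bundleEnds` on an edge outside `S` (`eA, eB ∈ S`): unchanged. -/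
lemma bundleEnds_apply_of_notMem (ends : E → Sym2 V) (S : Set E) [DecidablePred (· ∈ S)]
    {eA eB : E} (hA : eA ∈ S) (hB : eB ∈ S) (a₁ a₂ v : V) {e : E} (he : e ∉ S) :
    bundleEnds ends S eA eB a₁ a₂ v e = ends e := by
  have h1 : e ≠ eA := fun h => he (h ▸ hA)
  have h2 : e ≠ eB := fun h => he (h ▸ hB)
  simp [bundleEnds, h1, h2, he]

omit [DecidableEq E] in
/-- The admissible set is determined by the edges of `S`. -/
lemma dependsOn_bundleG₀ (ends : E → Sym2 V) (S : Set E) [DecidablePred (· ∈ S)] (a₁ a₂ : V) :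
    DependsOn (· ∈ BundleG₀ ends S a₁ a₂) S := by
  intro ω ω' h
  have hr : restrictTo S ω = restrictTo S ω' := restrictTo_eq_of_eqOn h
  show (¬ Conn ends (restrictTo S ω) a₁ a₂) = (¬ Conn ends (restrictTo S ω') a₁ a₂)
  rw [hr]

omit [DecidableEq E] in
/-- On the admissible set the two pattern observables are never both true (`a₁ ↔ v ↔ a₂`). -/
lemma not_both_of_mem_bundleG₀ (ends : E → Sym2 V) (S : Set E) [DecidablePred (· ∈ S)]
    (a₁ a₂ v : V) {ω : Config E} (hω : ω ∈ BundleG₀ ends S a₁ a₂) :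
    ¬ (blockObs ends S a₁ v ω = true ∧ blockObs ends S a₂ v ω = true) := by
  rintro ⟨h1, h2⟩
  rw [blockObs_eq_true_iff] at h1 h2
  exact hω (conn_trans h1 (conn_symm h2))

omit [DecidableEq E] in
/-- A configuration with `a₁ ↮ a₂` is admissible. -/
lemma mem_bundleG₀_of_not_conn (ends : E → Sym2 V) (S : Set E) [DecidablePred (· ∈ S)]
    (a₁ a₂ : V) {ω : Config E} (h : ¬ Conn ends ω a₁ a₂) : ω ∈ BundleG₀ ends S a₁ a₂ :=
  fun hc => h (conn_of_conn_restrictTo hc)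

end Defs

/-! ## Connectivity through the bundle -/

section Conn

variable {V : Type*} {E : Type*} [DecidableEq E]

/-- **The crossing of the bundle**: on an admissible configuration, two distinct terminals joined
inside `S` are joined in the bundle graph under the bundle map (by the open pattern edge). -/
lemma conn_bundle_of_terminals {ends : E → Sym2 V} {S : Set E} [DecidablePred (· ∈ S)]
    {eA eB : E} (hAB : eA ≠ eB) {a₁ a₂ v : V} {ends' : E → Sym2 V}
    (hends' : ends' = bundleEnds ends S eA eB a₁ a₂ v) {ω ω' : Config E}
    (hω' : ω' = bundleMap S eA eB (blockObs ends S a₁ v) (blockObs ends S a₂ v) ω)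
    (hG : ω ∈ BundleG₀ ends S a₁ a₂) {t t' : V} (ht : t = a₁ ∨ t = a₂ ∨ t = v)
    (ht' : t' = a₁ ∨ t' = a₂ ∨ t' = v) (hne : t ≠ t') (hc : Conn ends (restrictTo S ω) t t') :
    Conn ends' ω' t t' := by
  -- the two pattern edges, when open
  have hA : Conn ends (restrictTo S ω) a₁ v → Conn ends' ω' a₁ v := by
    intro h
    have hopen : ω' eA = true := by
      rw [hω', bundleMap_apply_A, blockObs_eq_true_iff]
      exact h
    have hend : ends' eA = s(a₁, v) := by rw [hends', bundleEnds_apply_A]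
    exact conn_of_openAdj ⟨eA, hopen, hend⟩
  have hB : Conn ends (restrictTo S ω) a₂ v → Conn ends' ω' a₂ v := by
    intro h
    have hopen : ω' eB = true := by
      rw [hω', bundleMap_apply_B S hAB, blockObs_eq_true_iff]
      exact h
    have hend : ends' eB = s(a₂, v) := by rw [hends', bundleEnds_apply_B ends S hAB]
    exact conn_of_openAdj ⟨eB, hopen, hend⟩
  rcases ht with rfl | rfl | rfl <;> rcases ht' with rfl | rfl | rfl
  · exact absurd rfl hne
  · exact absurd hc hG
  · exact hA hc
  · exact absurd (conn_symm hc) hG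
  · exact absurd rfl hne
  · exact hB hc
  · exact conn_symm (hA (conn_symm hc))
  · exact conn_symm (hB (conn_symm hc))
  · exact absurd rfl hne

/-- **Connectivity is carried by the collapse (from the original graph)**: on an admissible
configuration, if `x ↔ z` under `ω` with `x, z ∉ W`, then `x ↔ z` in the bundle graph under the
bundle map. -/
lemma conn_bundle_of_conn {ends : E → Sym2 V} {W : Set V} {a₁ a₂ v : V}
    (hW : IsBundle ends W a₁ a₂ v) {S : Set E} [DecidablePred (· ∈ S)]
    (hS : ∀ e, e ∈ S ↔ e ∈ touches ends W) {eA eB : E} (hA : eA ∈ S) (hB : eB ∈ S) (hAB : eA ≠ eB)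
    {ends' : E → Sym2 V} (hends' : ends' = bundleEnds ends S eA eB a₁ a₂ v) {ω ω' : Config E}
    (hω' : ω' = bundleMap S eA eB (blockObs ends S a₁ v) (blockObs ends S a₂ v) ω)
    (hG : ω ∈ BundleG₀ ends S a₁ a₂) {x z : V} (hx : x ∉ W) (hz : z ∉ W) (h : Conn ends ω x z) :
    Conn ends' ω' x z := by
  have hterm : ∀ t, (t = a₁ ∨ t = a₂ ∨ t = v) → t ∉ W := by
    rintro t (rfl | rfl | rfl)
    · exact hW.a₁_notMem
    · exact hW.a₂_notMem
    · exact hW.v_notMem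
  -- the closure set
  let T : Set V := {y | (y ∉ W ∧ Conn ends' ω' x y) ∨
    (y ∈ W ∧ ∃ t, (t = a₁ ∨ t = a₂ ∨ t = v) ∧ Conn ends' ω' x t ∧ Conn ends (restrictTo S ω) t y)}
  have hxT : x ∈ T := Or.inl ⟨hx, conn_refl _ _ _⟩
  have hclosed : ∀ e y y', ω e = true → ends e = s(y, y') → y ∈ T → y' ∈ T := by
    intro e y y' he hends hy
    by_cases heS : e ∈ S
    · -- an edge of the bundle: both ends in `W ∪ {a₁, a₂, v}`, open inside `S`
      obtain ⟨hy1, hy'1⟩ := hW.ends_mem e ((hS e).1 heS) y y' hends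
      have heS' : restrictTo S ω e = true := restrictTo_eq_true_of_mem heS he
      have hadj : Conn ends (restrictTo S ω) y y' := conn_of_openAdj ⟨e, heS', hends⟩
      -- the terminal reaching `y`, and the connection `t ↔ y'` inside `S`
      obtain ⟨t, ht, hxt, hty'⟩ : ∃ t, (t = a₁ ∨ t = a₂ ∨ t = v) ∧ Conn ends' ω' x t ∧
          Conn ends (restrictTo S ω) t y' := by
        rcases hy with ⟨hyW, hxy⟩ | ⟨hyW, t, ht, hxt, hty⟩
        · rcases hy1 with hyW' | ht
          · exact absurd hyW' hyW
          · exact ⟨y, ht, hxy, hadj⟩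
        · exact ⟨t, ht, hxt, conn_trans hty hadj⟩
      rcases hy'1 with hy'W | ht'
      · exact Or.inr ⟨hy'W, t, ht, hxt, hty'⟩
      · have hy'W : y' ∉ W := hterm y' ht'
        by_cases htt : t = y'
        · subst htt
          exact Or.inl ⟨hy'W, hxt⟩
        · exact Or.inl ⟨hy'W, conn_trans hxt
            (conn_bundle_of_terminals hAB hends' hω' hG ht ht' htt hty')⟩
    · -- an edge outside the bundle: unchanged in the collapse, both ends outside `W`
      have hyW : y ∉ W := fun hw => heS ((hS e).2 (mem_touches_of_ends hends (Or.inl hw)))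
      have hy'W : y' ∉ W := fun hw => heS ((hS e).2 (mem_touches_of_ends hends (Or.inr hw)))
      have hxy : Conn ends' ω' x y := by
        rcases hy with ⟨_, hxy⟩ | ⟨hyW', _⟩
        · exact hxy
        · exact absurd hyW' hyW
      have hopen : ω' e = true := by
        rw [hω', bundleMap_apply_of_notMem S hA hB _ _ ω heS]
        exact he
      have hend : ends' e = s(y, y') := by
        rw [hends', bundleEnds_apply_of_notMem ends S hA hB a₁ a₂ v heS]
        exact hends
      exact Or.inl ⟨hy'W, conn_trans hxy (conn_of_openAdj ⟨e, hopen, hend⟩)⟩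
  have hzT : z ∈ T := mem_of_conn_of_closed' hclosed hxT h
  rcases hzT with ⟨_, hxz⟩ | ⟨hzW, _⟩
  · exact hxz
  · exact absurd hzW hz

/-- **Connectivity is carried by the collapse (to the original graph)**: if `x ↔ z` in the bundle
graph under the bundle map, then `x ↔ z` under `ω`. -/
lemma conn_of_conn_bundle {ends : E → Sym2 V} {S : Set E} [DecidablePred (· ∈ S)] {eA eB : E}
    (hA : eA ∈ S) (hB : eB ∈ S) (hAB : eA ≠ eB) {a₁ a₂ v : V} {ends' : E → Sym2 V}
    (hends' : ends' = bundleEnds ends S eA eB a₁ a₂ v) {ω ω' : Config E}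
    (hω' : ω' = bundleMap S eA eB (blockObs ends S a₁ v) (blockObs ends S a₂ v) ω) {x z : V}
    (h : Conn ends' ω' x z) : Conn ends ω x z := by
  let T : Set V := {y | Conn ends ω x y}
  have hxT : x ∈ T := conn_refl _ _ _
  have hclosed : ∀ e y y', ω' e = true → ends' e = s(y, y') → y ∈ T → y' ∈ T := by
    intro e y y' he hends hy
    by_cases heA : e = eA
    · -- the pattern edge `{a₁, v}`: open only when `a₁ ↔ v` inside `S`
      subst heA
      have h1v : Conn ends (restrictTo S ω) a₁ v := by
        rw [hω', bundleMap_apply_A, blockObs_eq_true_iff] at he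
        exact he
      have h1v' : Conn ends ω a₁ v := conn_of_conn_restrictTo h1v
      rw [hends', bundleEnds_apply_A, Sym2.eq_iff] at hends
      rcases hends with ⟨rfl, rfl⟩ | ⟨rfl, rfl⟩
      · exact conn_trans hy h1v'
      · exact conn_trans hy (conn_symm h1v')
    · by_cases heB : e = eB
      · -- the pattern edge `{a₂, v}`
        subst heB
        have h2v : Conn ends (restrictTo S ω) a₂ v := by
          rw [hω', bundleMap_apply_B S hAB, blockObs_eq_true_iff] at he
          exact he
        have h2v' : Conn ends ω a₂ v := conn_of_conn_restrictTo h2v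
        rw [hends', bundleEnds_apply_B ends S hAB, Sym2.eq_iff] at hends
        rcases hends with ⟨rfl, rfl⟩ | ⟨rfl, rfl⟩
        · exact conn_trans hy h2v'
        · exact conn_trans hy (conn_symm h2v')
      · by_cases heS : e ∈ S
        · rw [hω', bundleMap_apply_of_mem S _ _ ω heA heB heS] at he
          exact absurd he Bool.false_ne_true
        · rw [hω', bundleMap_apply_of_notMem S hA hB _ _ ω heS] at he
          rw [hends', bundleEnds_apply_of_notMem ends S hA hB a₁ a₂ v heS] at hends
          exact conn_trans hy (conn_of_openAdj ⟨e, he, hends⟩)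
  exact mem_of_conn_of_closed' hclosed hxT h

/-- **Connectivity through a root bundle**: on an admissible configuration, for `x, z ∉ W`,
`x ↔ z` in the original graph under `ω` iff `x ↔ z` in the bundle graph under the bundle map. -/
theorem conn_bundle_iff {ends : E → Sym2 V} {W : Set V} {a₁ a₂ v : V}
    (hW : IsBundle ends W a₁ a₂ v) {S : Set E} [DecidablePred (· ∈ S)]
    (hS : ∀ e, e ∈ S ↔ e ∈ touches ends W) {eA eB : E} (hA : eA ∈ S) (hB : eB ∈ S) (hAB : eA ≠ eB)
    {ω : Config E} (hG : ω ∈ BundleG₀ ends S a₁ a₂) {x z : V} (hx : x ∉ W) (hz : z ∉ W) :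
    Conn ends ω x z ↔ Conn (bundleEnds ends S eA eB a₁ a₂ v)
      (bundleMap S eA eB (blockObs ends S a₁ v) (blockObs ends S a₂ v) ω) x z :=
  ⟨conn_bundle_of_conn hW hS hA hB hAB rfl rfl hG hx hz, conn_of_conn_bundle hA hB hAB rfl rfl⟩

/-- Outside the admissible set of the bundle graph (both pattern edges open) the roots are
connected through `v`. -/
lemma conn_roots_bundle_of_not_mem_bundleG (ends : E → Sym2 V) (S : Set E)
    [DecidablePred (· ∈ S)] {eA eB : E} (hAB : eA ≠ eB) (a₁ a₂ v : V) {ω : Config E}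
    (hω : ω ∉ BundleG eA eB) : Conn (bundleEnds ends S eA eB a₁ a₂ v) ω a₁ a₂ := by
  have h : ω eA = true ∧ ω eB = true := by
    by_contra hc
    exact hω hc
  exact conn_trans (conn_of_openAdj ⟨eA, h.1, bundleEnds_apply_A ends S eA eB a₁ a₂ v⟩)
    (conn_symm (conn_of_openAdj ⟨eB, h.2, bundleEnds_apply_B ends S hAB a₁ a₂ v⟩))

end Conn

end Bundle

end Summit.Ventures.PercRepro2
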